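import Summits.Ventures.AbcSig.Rows.XTemplateC
import Summits.Ventures.AbcSig.Levels.N6962

/-!
# Venture AbcSig — ROW `XnYn59Z2Even`: `xⁿ + yⁿ = 59 z²` (`xy` even) over NORM-FORM level certificates (GENERATED by p-lean g4 `gen4/cprow.py`)

HONEST FRAMING. A row of a COMPUTATION cell (`pub-abcsig`); a CONDITIONAL theorem, no claim on ABC or any summit.
Hypotheses: `BS04Package` (CITED: [BS04] Lemma 3.3 + (3.1) + Lemma 4.2); per level `DataComplete` (COMPUTED: the orbit list
of the certified engine level file is complete) and, for the norm-form level files, `RefinesCPSymAll` (COMPUTED: the listed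
characteristic polynomials annihilate `± c_ℓ` on the newforms matching each orbit datum — same engine file); and the listed
per-orbit exclusions `hX_…` (CITED: the row of record names the printed argument / cell module for each — [BS04, Prop. 4.4 /
4.6], M4 Kraus, M6c, M2·; nothing of those is checked here). Everything else is kernel-checked: the recipe templates and the
level files 6962 (norm-form certificates `Sieve/CharpolyCert.lean` + `RefinesCPSymAll`). Exponent range: prime `n ≥ 11`, `n ∤ 59`.
Residues closed by the row of record and CITED here: 6962.6 @ 11 by module M4 (Kraus, two implementations); 6962.37/.38 (degree 42) @ 29 by module M6χ (Eisenstein congruence with the quadratic character pair; p1 certificate, second engine) — see the row's R3; every other (orbit, exponent ≥ 11, ≠ 59) pair is killed IN THE KERNEL by the norm-form certificates (the four pairs 6962.19/.20 @ 11 and 6962.23/.24 @ 19 where the norm form is weaker by prime-ideal trees).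
Residues / orbits left as CITED hypotheses: N6962 orbit_6962_6 @ [11]: CITED hX_; N6962 orbit_6962_37 @ [29]: CITED hX_; N6962 orbit_6962_38 @ [29]: CITED hX_.
Row of record: `census/rows/C1/C1-C59-even.md` (sha16 `a6e1c3121a82fd52`; R8 SIGNED 2026-08-23T03:24:14Z by referee (ref-g23)); p1's statement of record: `Rows.C1CellEven 59 11 ∅` (`Rows/StatementsC1b.lean` / `Rows/Statements.lean`).
-/

namespace Summit.Ventures.AbcSig

/-- Row `XnYn59Z2Even`: no primitive solution of `xⁿ + yⁿ = 59 z²` (`xy` even) for prime `n ≥ 11`, `n ∤ 59`,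
conditional on the named hypotheses (norm-form level certificates in the kernel). -/
theorem xrow_XnYn59Z2Even (M : NewformModel) (hP : M.BS04Package)
    (hD6962 : M.DataComplete 6962 level6962Orbits) (hCP6962 : M.RefinesCPSymAll 6962 level6962CP)
    (n : ℕ) (hn : n.Prime) (hmin : 11 ≤ n) (hnC : ¬ n ∣ 59)
    (hX_orbit_6962_6 : n ∈ ([11] : List ℕ) → M.Excludes 6962 orbit_6962_6
      (fun S => S.A = 1 ∧ S.B = 1 ∧ S.C = 59 ∧ S.n = n ∧ 2 ∣ S.a * S.b))
    (hX_orbit_6962_37 : n ∈ ([29] : List ℕ) → M.Excludes 6962 orbit_6962_37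
      (fun S => S.A = 1 ∧ S.B = 1 ∧ S.C = 59 ∧ S.n = n ∧ 2 ∣ S.a * S.b))
    (hX_orbit_6962_38 : n ∈ ([29] : List ℕ) → M.Excludes 6962 orbit_6962_38
      (fun S => S.A = 1 ∧ S.B = 1 ∧ S.C = 59 ∧ S.n = n ∧ 2 ∣ S.a * S.b))
    (a b c : ℤ) (hpar : 2 ∣ a * b) : ¬ IsPrimitiveSolution 1 1 59 n a b c := by
  have h7 : 7 ≤ n := by omega
  have hC : Nat.Prime 59 := by norm_num
  have hsq : Squarefree (59 : ℕ) := (Nat.prime_iff.mp hC).squarefree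
  exact xrow_template_even 59 hsq (by decide) M hP hD6962 n hn h7 hnC
    (level6962_sieve M hP hCP6962 n hn h7 (fun o => M.Excludes 6962 o
      (fun S => S.A = 1 ∧ S.B = 1 ∧ S.C = 59 ∧ S.n = n ∧ 2 ∣ S.a * S.b) ∨ M.ExcludesStd 6962 o n) (fun _ h => Or.inr h) (fun hmem => by
      obtain rfl : n = 7 := by simpa using hmem
      omega) (fun hmem => by
      obtain rfl : n = 7 := by simpa using hmem
      omega) (fun hmem => by
      obtain rfl : n = 7 := by simpa using hmem
      omega) (fun hmem => by
      obtain rfl : n = 7 := by simpa using hmem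
      omega) (fun hmem => by
      obtain rfl : n = 7 := by simpa using hmem
      omega) (fun hmem => by
      rcases (by simpa using hmem : n = 7 ∨ n = 11) with rfl | rfl
      · omega
      · exact Or.inl (hX_orbit_6962_6 (by simp))) (fun hmem => by
      obtain rfl : n = 7 := by simpa using hmem
      omega) (fun hmem => by
      obtain rfl : n = 7 := by simpa using hmem
      omega) (fun hmem => by
      obtain rfl : n = 7 := by simpa using hmem
      omega) (fun hmem => by
      obtain rfl : n = 7 := by simpa using hmem
      omega) (fun hmem => by
      obtain rfl : n = 59 := by simpa using hmem
      exact absurd (dvd_refl 59) hnC) (fun hmem => by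
      obtain rfl : n = 59 := by simpa using hmem
      exact absurd (dvd_refl 59) hnC) (fun hmem => by
      rcases (by simpa using hmem : n = 29 ∨ n = 59) with rfl | rfl
      · exact Or.inl (hX_orbit_6962_37 (by simp))
      · exact absurd (dvd_refl 59) hnC) (fun hmem => by
      rcases (by simpa using hmem : n = 29 ∨ n = 59) with rfl | rfl
      · exact Or.inl (hX_orbit_6962_38 (by simp))
      · exact absurd (dvd_refl 59) hnC))
    a b c hpar

end Summit.Ventures.AbcSig
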